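import Summits.QuantumFields.BalabanUV.T4Continuum.Support.NE7EffectiveFormLowerBoundUniform
import Summits.QuantumFields.BalabanUV.T4Continuum.Support.NE7EffectiveFormLowerBoundFinal
import Summits.QuantumFields.BalabanUV.T4Continuum.Support.NE3ClassSlicePoincare
import HarnessLib

/-!
# NE7EffectiveFormLowerBoundFinalUniform — (G′) AT d = 4, ε-LINES PACKAGED AND DATUM RADIUS LEVEL-UNIFORM: `∃ ε₀ > 0 ∀ 0 < ε < ε₀ ∀ N ≥ 1 ∃ δV > 0 ∀ j ∀ V₀ ∀ U♯ ∀ θ ∀ v`, and the SU(2)∕SU(3),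
# L = 2 corollaries with NO numeric hypothesis (lineage `b2b-balaban-t4-ne7-p1`, gen 119, file U4b of the uniform (G′) chain: H17 and H18 re-issued on U4a)

Cell `pub-balaban`, rung (B)+1 sub-cell t4, CRUX PROVER NE7 #1 (OWNER of row NE7), generation 119.
WHY.  ✓ H17∕H18 have `∀ N ∀ j ∃ δV`; ✓ U4a `effectiveForm_lower_bound_class_uniform` has `∀ N ∃ δV ∀ j`.  THIS FILE repeats H17's packaging of the seventeen ε-lines (right-neighbourhood
basis of `0`) and H18's numeric instances (row NE3's `lines_d4_L2_c2∕c3`) on U4a.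
WHAT ([folklore]; 0 def, 0 sorry; d = 4): **`effectiveForm_lower_bound_final_uniform`**, **`effectiveForm_lower_bound_SU2_L2_uniform`**, **`effectiveForm_lower_bound_SU3_L2_uniform`**.
HONEST FRAMING (page 1): (G′) is row NE7's binder target about OUR lattice objects in the all-data frame («∃ δV ∀ V₀ δV-small», `ε₀`, `δV` not computed); NOT Bałaban's NE7 as printed, NOT a
spine node by itself (spine 0∕9 until the NE7 record consumes it); nothing of Bałaban's asserted; finite T⁴ rung (B)+1 — NOT continuum YM on ℝ⁴, NOT infinite volume, NOT mass gap, NOT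
BetaPertH, NOT Clay.
-/

set_option autoImplicit false

open scoped BigOperators Matrix Matrix.Norms.L2Operator Topology
open NormedSpace Finset Set Filter Metric

namespace Summit.QuantumFields.BalabanUV.T4Continuum.NE7EffectiveFormLowerBoundFinalUniform

open Literature.MathematicalPhysics.QuantumFieldTheory.Balaban1983to89
open B7Prop1Explicit B7Prop2Explicit MatrixLog UnitaryModel
open T4AveragingDeficitWall (IsUnitaryCfg IsSkewDir SmallField Ad curl curlAt curlSq dirSq dirL1 fineAction)
open T4AveragingDeficitWallBoundary (IsPeriodicCfg periodBox)
open AveragingDeficitTorusChart (TDir chart chartDir resDir extDir)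
open AveragingDeficitTwoLevelPrep (twoLevelSmall skewSub skewPR)
open AveragingDeficitMultiLevelPrep (cavgIter tower levelQ levelQ' LevelSmall tower_ne_zero)
open MatrixNorms (nhsNormSq)
open MinimalActionLevels (perWin stepWt)
open MinimalActionSandwich (IsMinimiser minAct)
open MinimalActionRate (sfClass)
open NE7RadIterUniform (radD)
open NE7StraightTowerCurlEnergy (eC mC)
open NE3QbarIterCovLiftPrep (cruxC)
open NE3RightInverseSolveLetters (thetaLoc)
open NE7SliceRepHessianFloor (liftMassC liftCurlC)
open NE3HatInvCurlLetters (curl1C)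
open BlockAverageVaryHolo (nbRad)
open NE3CovariantLineSumsError (Csup)
open NE3CovariantLineSumsL2 (C2sq)
open NE3CovariantLineSumsL2Tower (rho)
open ShellMeasureAverageProp4General (C1cov)
open NE3SlicePoincareBudgetLine (ShLine SmallYLine CPLine)
open NE7EffectiveFormLowerBoundFinal (eventually_nhdsGT_mul_le')
open NE7EffectiveFormLowerBoundUniform (effectiveForm_lower_bound_class_uniform)
open NE3ClassSlicePoincare (lines_d4_L2_c2 lines_d4_L2_c3)

noncomputable section

variable {n : Type} [Fintype n] [DecidableEq n]

/-- **(G′) AT d = 4, ε-LINES PACKAGED INTO ONE `ε₀ > 0`, LEVEL-UNIFORM DATUM RADIUS** (`∀ N ∃ δV ∀ j`; see the module docstring; `C_P := CPLine 4 L (card n) ε_c τ`, `C_Λ(ε) := 2·curl1C·ε·(128·C₁L²·4(4L+1)⁴·L²)`). [folklore] -/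
theorem effectiveForm_lower_bound_final_uniform [Nonempty n] {L : ℕ} [NeZero L] (hL : 2 ≤ L) {τ εc : ℝ} (hτ : 0 < τ) (hεc : 0 < εc)
    (h1 : ShLine 4 L (Fintype.card n) εc τ ≤ 1 / 2) (h2 : SmallYLine 4 L (Fintype.card n) εc τ ≤ 1 / 2)
    (h3 : 68 / 3 * ((((4 : ℕ) : ℝ) + 1) * (((4 : ℕ) : ℝ) + 4)) * C2sq 4 L * τ ≤ rho 4 L / 2)
    (h4 : 8 * ((4 : ℕ) : ℝ) * ((((4 : ℕ) : ℝ) - 1) * τ) ^ 2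
        + 2 * ((Fintype.card n : ℝ) * ((4 * ((4 : ℕ) : ℝ) ^ 2 + 272 * ((4 : ℕ) : ℝ) * ((((4 : ℕ) : ℝ) + 1) * (((4 : ℕ) : ℝ) + 4))) * τ) ^ 2) ≤ 1 / 2) :
    ∃ ε₀ : ℝ, 0 < ε₀ ∧ ∀ ε : ℝ, 0 < ε → ε < ε₀ →
      ∀ (N : ℕ) [NeZero N], 1 ≤ N →
      ∃ δV : ℝ, 0 < δV ∧ ∀ j : ℕ,
        ∀ V₀ ∈ {V : Site 4 → Fin 4 → (Matrix n n ℂ)ˣ | IsUnitaryCfg V ∧ IsPeriodicCfg V (N : ℤ) ∧ SmallField V δV},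
        ∀ Us : Site 4 → Fin 4 → (Matrix n n ℂ)ˣ, IsMinimiser 4 (sfClass 4 L N ε) L N (j + 1) V₀ Us → ∀ θ : ℝ, 0 < θ →
        ∀ v : ↥(skewSub 4 n N),
          (1 - (2 * curl1C 4 L * ε * (128 * (C1cov 4 * (L : ℝ) ^ 2 * (4 * (4 * (L : ℝ) + 1) ^ 4)) * (L : ℝ) ^ 2)) * (2 * (4 * CPLine 4 L (Fintype.card n) εc τ * Fintype.card n)))
              * (((stepWt 4 L)⁻¹) ^ (j + 1) * ∑ P ∈ perWin 4 N, nhsNormSq (curl V₀ (chartDir (ContinuousLinearMap.id ℝ (Matrix n n ℂ)) N (v : TDir 4 n N)) P))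
            ≤ ((1 + θ) + 2 * ((1 + θ) * (14 * (Fintype.card (T4AveragingDeficitWall.Plane 4) : ℝ) * ε) + (1 + θ⁻¹) * (36 * eC 4 L (Fintype.card n) ^ 2 * ε ^ 2))
                    * (4 * CPLine 4 L (Fintype.card n) εc τ * Fintype.card n))
                * fderiv ℝ (fderiv ℝ (fun y : ↥(skewSub 4 n N) => minAct 4 (sfClass 4 L N ε) L N (j + 1) (chart (ContinuousLinearMap.id ℝ (Matrix n n ℂ)) N V₀ (y : TDir 4 n N)))) 0 v v
              + ((stepWt 4 L)⁻¹) ^ (j + 1)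
                * (2 * (((1 + θ) + 2 * ((1 + θ) * (14 * (Fintype.card (T4AveragingDeficitWall.Plane 4) : ℝ) * ε) + (1 + θ⁻¹) * (36 * eC 4 L (Fintype.card n) ^ 2 * ε ^ 2))
                        * (4 * CPLine 4 L (Fintype.card n) εc τ * Fintype.card n)))
                      * (2 * curl1C 4 L * ε * (128 * (C1cov 4 * (L : ℝ) ^ 2 * (4 * (4 * (L : ℝ) + 1) ^ 4)) * (L : ℝ) ^ 2)) * (2 * liftMassC 4 L + 4 * CPLine 4 L (Fintype.card n) εc τ * liftCurlC 4 L)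
                    + (1 - (2 * curl1C 4 L * ε * (128 * (C1cov 4 * (L : ℝ) ^ 2 * (4 * (4 * (L : ℝ) + 1) ^ 4)) * (L : ℝ) ^ 2)) * (2 * (4 * CPLine 4 L (Fintype.card n) εc τ * Fintype.card n)))
                      * (2 * ((1 + θ) * (14 * (Fintype.card (T4AveragingDeficitWall.Plane 4) : ℝ) * ε) + (1 + θ⁻¹) * (36 * eC 4 L (Fintype.card n) ^ 2 * ε ^ 2))
                        * (2 * liftMassC 4 L + 4 * CPLine 4 L (Fintype.card n) εc τ * liftCurlC 4 L)))
                * dirSq (chartDir (ContinuousLinearMap.id ℝ (Matrix n n ℂ)) N (v : TDir 4 n N)) (periodBox N) := by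
  have hL1 : 1 ≤ L := le_trans (by norm_num) hL
  have hL0 : (0 : ℝ) < L := by exact_mod_cast (show 0 < L by omega)
  obtain ⟨ε₁, hε₁, T⟩ := effectiveForm_lower_bound_class_uniform (n := n) hL
  have hc2 : 0 < c2' 4 L := c2'_pos 4 L hL1
  have hrate : 0 < ((L : ℝ) / (L : ℝ) ^ 4) / 2 := by positivity
  -- the seventeen ε-lines (and `ε ≤ ε₁`), each for all small `ε > 0`
  have e0 := eventually_nhdsGT_mul_le' (1 : ℝ) hε₁
  have e1 := eventually_nhdsGT_mul_le' (8 * radD 4 L * (((L : ℝ) ^ 2)⁻¹) ^ 2) one_pos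
  have e2 := eventually_nhdsGT_mul_le' (4 * twoLevelSmall 4 L * ((L : ℝ) ^ 2)⁻¹) one_pos
  have e3 := eventually_nhdsGT_mul_le' (8 * (L : ℝ) * mC 4 L (Fintype.card n) * ((L : ℝ) ^ 2)⁻¹) one_pos
  have e4 := eventually_nhdsGT_mul_le' (1 : ℝ) one_pos
  have e5 := eventually_nhdsGT_mul_le' (cruxC 4 L) (c := 1 / 2) (by norm_num)
  have e6 := eventually_nhdsGT_mul_le' (thetaLoc 4 L) (c := 1 / 2) (by norm_num)
  have e7 := eventually_nhdsGT_mul_le' (43584 : ℝ) (c := 1 / 2) (by norm_num)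
  have e8 := eventually_nhdsGT_mul_le' (6 * C0 4) (c := 1 / 3) (by norm_num)
  have e9 := eventually_nhdsGT_mul_le' (24 : ℝ) hc2
  have e10 := eventually_nhdsGT_mul_le' (12 * (800 * (((4 : ℕ) : ℝ) + 1) ^ 2 * (((4 : ℕ) : ℝ) + 4))) (c := 1 / 4) (by norm_num)
  have e11 := eventually_nhdsGT_mul_le' (4 * radD 4 L * (((L : ℝ) ^ 2)⁻¹) ^ 2) one_pos
  have e12 := eventually_nhdsGT_mul_le' ((16 * ((4 : ℝ) + 1) * ((4 : ℝ) + 4) * (L : ℝ) ^ 2 * Csup 4 L * (4 * (2 * (nbRad 4 L : ℝ) + 1) ^ 4)) * (8 / 3 * ((L : ℝ) ^ 2)⁻¹)) hrate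
  have e13 := eventually_nhdsGT_mul_le' (1 : ℝ) hτ
  have e14 := eventually_nhdsGT_mul_le' (16 * (14464 * (((4 : ℕ) : ℝ) + 1) ^ 2 * (((4 : ℕ) : ℝ) + 4) ^ 2)) (c := 3) (by norm_num)
  have e15 := eventually_nhdsGT_mul_le' (2 * twoLevelSmall 4 L) (c := (L : ℝ) ^ 2) (by positivity)
  have e16 := eventually_nhdsGT_mul_le' (28 * (Fintype.card (T4AveragingDeficitWall.Plane 4) : ℝ) * (4 * CPLine 4 L (Fintype.card n) εc τ * Fintype.card n)) one_pos
  have e17 := eventually_nhdsGT_mul_le'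
    ((2 * curl1C 4 L * (128 * (C1cov 4 * (L : ℝ) ^ 2 * (4 * (4 * (L : ℝ) + 1) ^ 4)) * (L : ℝ) ^ 2)) * (2 * (4 * CPLine 4 L (Fintype.card n) εc τ * Fintype.card n))) one_pos
  have hev : ∀ᶠ ε in 𝓝[>] (0 : ℝ), ∀ (N : ℕ) [NeZero N], 1 ≤ N →
      ∃ δV : ℝ, 0 < δV ∧ ∀ j : ℕ,
        ∀ V₀ ∈ {V : Site 4 → Fin 4 → (Matrix n n ℂ)ˣ | IsUnitaryCfg V ∧ IsPeriodicCfg V (N : ℤ) ∧ SmallField V δV},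
        ∀ Us : Site 4 → Fin 4 → (Matrix n n ℂ)ˣ, IsMinimiser 4 (sfClass 4 L N ε) L N (j + 1) V₀ Us → ∀ θ : ℝ, 0 < θ →
        ∀ v : ↥(skewSub 4 n N),
          (1 - (2 * curl1C 4 L * ε * (128 * (C1cov 4 * (L : ℝ) ^ 2 * (4 * (4 * (L : ℝ) + 1) ^ 4)) * (L : ℝ) ^ 2)) * (2 * (4 * CPLine 4 L (Fintype.card n) εc τ * Fintype.card n)))
              * (((stepWt 4 L)⁻¹) ^ (j + 1) * ∑ P ∈ perWin 4 N, nhsNormSq (curl V₀ (chartDir (ContinuousLinearMap.id ℝ (Matrix n n ℂ)) N (v : TDir 4 n N)) P))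
            ≤ ((1 + θ) + 2 * ((1 + θ) * (14 * (Fintype.card (T4AveragingDeficitWall.Plane 4) : ℝ) * ε) + (1 + θ⁻¹) * (36 * eC 4 L (Fintype.card n) ^ 2 * ε ^ 2))
                    * (4 * CPLine 4 L (Fintype.card n) εc τ * Fintype.card n))
                * fderiv ℝ (fderiv ℝ (fun y : ↥(skewSub 4 n N) => minAct 4 (sfClass 4 L N ε) L N (j + 1) (chart (ContinuousLinearMap.id ℝ (Matrix n n ℂ)) N V₀ (y : TDir 4 n N)))) 0 v v
              + ((stepWt 4 L)⁻¹) ^ (j + 1)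
                * (2 * (((1 + θ) + 2 * ((1 + θ) * (14 * (Fintype.card (T4AveragingDeficitWall.Plane 4) : ℝ) * ε) + (1 + θ⁻¹) * (36 * eC 4 L (Fintype.card n) ^ 2 * ε ^ 2))
                        * (4 * CPLine 4 L (Fintype.card n) εc τ * Fintype.card n)))
                      * (2 * curl1C 4 L * ε * (128 * (C1cov 4 * (L : ℝ) ^ 2 * (4 * (4 * (L : ℝ) + 1) ^ 4)) * (L : ℝ) ^ 2)) * (2 * liftMassC 4 L + 4 * CPLine 4 L (Fintype.card n) εc τ * liftCurlC 4 L)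
                    + (1 - (2 * curl1C 4 L * ε * (128 * (C1cov 4 * (L : ℝ) ^ 2 * (4 * (4 * (L : ℝ) + 1) ^ 4)) * (L : ℝ) ^ 2)) * (2 * (4 * CPLine 4 L (Fintype.card n) εc τ * Fintype.card n)))
                      * (2 * ((1 + θ) * (14 * (Fintype.card (T4AveragingDeficitWall.Plane 4) : ℝ) * ε) + (1 + θ⁻¹) * (36 * eC 4 L (Fintype.card n) ^ 2 * ε ^ 2))
                        * (2 * liftMassC 4 L + 4 * CPLine 4 L (Fintype.card n) εc τ * liftCurlC 4 L)))
                * dirSq (chartDir (ContinuousLinearMap.id ℝ (Matrix n n ℂ)) N (v : TDir 4 n N)) (periodBox N) := by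
    filter_upwards [self_mem_nhdsWithin, e0, e1, e2, e3, e4, e5, e6, e7, e8, e9, e10, e11, e12, e13, e14, e15, e16, e17]
      with ε hε0 l0 l1 l2 l3 l4 l5 l6 l7 l8 l9 l10 l11 l12 l13 l14 l15 l16 l17
    have hε : 0 < ε := hε0
    -- the exponential line from `12·c·ε ≤ 1/4`
    have hx0 : 0 ≤ 4 * (800 * (((4 : ℕ) : ℝ) + 1) ^ 2 * (((4 : ℕ) : ℝ) + 4)) * (3 * ε) := by positivity
    have hx : 4 * (800 * (((4 : ℕ) : ℝ) + 1) ^ 2 * (((4 : ℕ) : ℝ) + 4)) * (3 * ε) ≤ 1 / 4 := by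
      calc 4 * (800 * (((4 : ℕ) : ℝ) + 1) ^ 2 * (((4 : ℕ) : ℝ) + 4)) * (3 * ε) = ε * (12 * (800 * (((4 : ℕ) : ℝ) + 1) ^ 2 * (((4 : ℕ) : ℝ) + 4))) := by ring
        _ ≤ 1 / 4 := l10
    have hroom : Real.exp (4 * (800 * (((4 : ℕ) : ℝ) + 1) ^ 2 * (((4 : ℕ) : ℝ) + 4)) * (3 * ε)) ≤ 3 / 2 := by
      set x : ℝ := 4 * (800 * (((4 : ℕ) : ℝ) + 1) ^ 2 * (((4 : ℕ) : ℝ) + 4)) * (3 * ε) with hxdef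
      have h := Real.abs_exp_sub_one_le (x := x) (by rw [abs_of_nonneg hx0]; linarith)
      rw [abs_of_nonneg hx0] at h
      have h' := (abs_le.mp h).2
      linarith
    -- each line in the literal form of H16
    have m1 : 4 * (2 * ε) * radD 4 L * (((L : ℝ) ^ 2)⁻¹) ^ 2 ≤ 1 := by
      calc 4 * (2 * ε) * radD 4 L * (((L : ℝ) ^ 2)⁻¹) ^ 2 = ε * (8 * radD 4 L * (((L : ℝ) ^ 2)⁻¹) ^ 2) := by ring
        _ ≤ 1 := l1
    have m2 : twoLevelSmall 4 L * (2 * (2 * ε) * ((L : ℝ) ^ 2)⁻¹) ≤ 1 := by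
      calc twoLevelSmall 4 L * (2 * (2 * ε) * ((L : ℝ) ^ 2)⁻¹) = ε * (4 * twoLevelSmall 4 L * ((L : ℝ) ^ 2)⁻¹) := by ring
        _ ≤ 1 := l2
    have m3 : 8 * (L : ℝ) * mC 4 L (Fintype.card n) * ε * ((L : ℝ) ^ 2)⁻¹ ≤ 1 := by
      calc 8 * (L : ℝ) * mC 4 L (Fintype.card n) * ε * ((L : ℝ) ^ 2)⁻¹ = ε * (8 * (L : ℝ) * mC 4 L (Fintype.card n) * ((L : ℝ) ^ 2)⁻¹) := by ring
        _ ≤ 1 := l3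
    have m4 : ε ≤ 1 := by linarith
    have m5 : cruxC 4 L * ε < 1 := by linarith [mul_comm (cruxC 4 L) ε]
    have m6 : thetaLoc 4 L * ε ≤ 1 / 2 := by rw [mul_comm]; exact l6
    have m7 : 43584 * ε ≤ 1 / 2 := by linarith
    have m8 : C0 4 * (2 * (3 * ε)) ≤ 1 / 3 := by
      calc C0 4 * (2 * (3 * ε)) = ε * (6 * C0 4) := by ring
        _ ≤ 1 / 3 := l8
    have m9 : 4 * (2 * (3 * ε)) ≤ c2' 4 L := by linarith
    have m11 : 4 * ε * radD 4 L * (((L : ℝ) ^ 2)⁻¹) ^ 2 ≤ 1 := by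
      calc 4 * ε * radD 4 L * (((L : ℝ) ^ 2)⁻¹) ^ 2 = ε * (4 * radD 4 L * (((L : ℝ) ^ 2)⁻¹) ^ 2) := by ring
        _ ≤ 1 := l11
    have m12 : (16 * ((4 : ℝ) + 1) * ((4 : ℝ) + 4) * (L : ℝ) ^ 2 * Csup 4 L * (4 * (2 * (nbRad 4 L : ℝ) + 1) ^ 4)) * (8 / 3 * ε * ((L : ℝ) ^ 2)⁻¹)
        ≤ ((L : ℝ) / (L : ℝ) ^ 4) / 2 := by
      calc (16 * ((4 : ℝ) + 1) * ((4 : ℝ) + 4) * (L : ℝ) ^ 2 * Csup 4 L * (4 * (2 * (nbRad 4 L : ℝ) + 1) ^ 4)) * (8 / 3 * ε * ((L : ℝ) ^ 2)⁻¹)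
          = ε * ((16 * ((4 : ℝ) + 1) * ((4 : ℝ) + 4) * (L : ℝ) ^ 2 * Csup 4 L * (4 * (2 * (nbRad 4 L : ℝ) + 1) ^ 4)) * (8 / 3 * ((L : ℝ) ^ 2)⁻¹)) := by ring
        _ ≤ ((L : ℝ) / (L : ℝ) ^ 4) / 2 := l12
    have m13 : ε ≤ τ := by linarith
    have m14 : 16 * (14464 * (((4 : ℕ) : ℝ) + 1) ^ 2 * (((4 : ℕ) : ℝ) + 4) ^ 2) * ε ≤ 3 := by rw [mul_comm]; exact l14
    have m15 : 2 * twoLevelSmall 4 L * ε ≤ (L : ℝ) ^ 2 := by rw [mul_comm]; exact l15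
    have m16 : 28 * (Fintype.card (T4AveragingDeficitWall.Plane 4) : ℝ) * ε * (4 * CPLine 4 L (Fintype.card n) εc τ * Fintype.card n) ≤ 1 := by
      calc 28 * (Fintype.card (T4AveragingDeficitWall.Plane 4) : ℝ) * ε * (4 * CPLine 4 L (Fintype.card n) εc τ * Fintype.card n)
          = ε * (28 * (Fintype.card (T4AveragingDeficitWall.Plane 4) : ℝ) * (4 * CPLine 4 L (Fintype.card n) εc τ * Fintype.card n)) := by ring
        _ ≤ 1 := l16
    have m17 : (2 * curl1C 4 L * ε * (128 * (C1cov 4 * (L : ℝ) ^ 2 * (4 * (4 * (L : ℝ) + 1) ^ 4)) * (L : ℝ) ^ 2)) * (2 * (4 * CPLine 4 L (Fintype.card n) εc τ * Fintype.card n)) ≤ 1 := by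
      calc (2 * curl1C 4 L * ε * (128 * (C1cov 4 * (L : ℝ) ^ 2 * (4 * (4 * (L : ℝ) + 1) ^ 4)) * (L : ℝ) ^ 2)) * (2 * (4 * CPLine 4 L (Fintype.card n) εc τ * Fintype.card n))
          = ε * ((2 * curl1C 4 L * (128 * (C1cov 4 * (L : ℝ) ^ 2 * (4 * (4 * (L : ℝ) + 1) ^ 4)) * (L : ℝ) ^ 2)) * (2 * (4 * CPLine 4 L (Fintype.card n) εc τ * Fintype.card n))) := by ring
        _ ≤ 1 := l17
    intro N _ hN
    exact T ε hε (by linarith) m1 m2 m3 m4 m5 m6 m7 m8 m9 hroom m11 m12 τ εc m13 hεc m14 m15 h1 h2 h3 h4 m16 m17 N hN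
  obtain ⟨ε₀, hε₀, H⟩ := (nhdsGT_basis (0 : ℝ)).eventually_iff.mp hev
  exact ⟨ε₀, hε₀, fun ε hε hεlt N _ hN => H ⟨hε, hεlt⟩ N hN⟩

/-- **(G′) FOR SU(2) AT d = 4, L = 2, NO NUMERIC HYPOTHESIS, LEVEL-UNIFORM DATUM RADIUS** (`C_P = CPLine 4 2 2 10⁻¹⁷ 10⁻⁵³ ≤ 1234·10¹⁴`). [folklore] -/
theorem effectiveForm_lower_bound_SU2_L2_uniform [Nonempty n] (hn : Fintype.card n = 2) :
    ∃ ε₀ : ℝ, 0 < ε₀ ∧ ∀ ε : ℝ, 0 < ε → ε < ε₀ →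
      ∀ (N : ℕ) [NeZero N], 1 ≤ N →
      ∃ δV : ℝ, 0 < δV ∧ ∀ j : ℕ,
        ∀ V₀ ∈ {V : Site 4 → Fin 4 → (Matrix n n ℂ)ˣ | IsUnitaryCfg V ∧ IsPeriodicCfg V (N : ℤ) ∧ SmallField V δV},
        ∀ Us : Site 4 → Fin 4 → (Matrix n n ℂ)ˣ, IsMinimiser 4 (sfClass 4 2 N ε) 2 N (j + 1) V₀ Us → ∀ θ : ℝ, 0 < θ →
        ∀ v : ↥(skewSub 4 n N),
          (1 - (2 * curl1C 4 2 * ε * (128 * (C1cov 4 * ((2 : ℕ) : ℝ) ^ 2 * (4 * (4 * ((2 : ℕ) : ℝ) + 1) ^ 4)) * ((2 : ℕ) : ℝ) ^ 2)) * (2 * (4 * CPLine 4 2 (Fintype.card n) (1 / 10 ^ 17) (1 / 10 ^ 53) * Fintype.card n)))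
              * (((stepWt 4 2)⁻¹) ^ (j + 1) * ∑ P ∈ perWin 4 N, nhsNormSq (curl V₀ (chartDir (ContinuousLinearMap.id ℝ (Matrix n n ℂ)) N (v : TDir 4 n N)) P))
            ≤ ((1 + θ) + 2 * ((1 + θ) * (14 * (Fintype.card (T4AveragingDeficitWall.Plane 4) : ℝ) * ε) + (1 + θ⁻¹) * (36 * eC 4 2 (Fintype.card n) ^ 2 * ε ^ 2))
                    * (4 * CPLine 4 2 (Fintype.card n) (1 / 10 ^ 17) (1 / 10 ^ 53) * Fintype.card n))
                * fderiv ℝ (fderiv ℝ (fun y : ↥(skewSub 4 n N) => minAct 4 (sfClass 4 2 N ε) 2 N (j + 1) (chart (ContinuousLinearMap.id ℝ (Matrix n n ℂ)) N V₀ (y : TDir 4 n N)))) 0 v v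
              + ((stepWt 4 2)⁻¹) ^ (j + 1)
                * (2 * (((1 + θ) + 2 * ((1 + θ) * (14 * (Fintype.card (T4AveragingDeficitWall.Plane 4) : ℝ) * ε) + (1 + θ⁻¹) * (36 * eC 4 2 (Fintype.card n) ^ 2 * ε ^ 2))
                        * (4 * CPLine 4 2 (Fintype.card n) (1 / 10 ^ 17) (1 / 10 ^ 53) * Fintype.card n)))
                      * (2 * curl1C 4 2 * ε * (128 * (C1cov 4 * ((2 : ℕ) : ℝ) ^ 2 * (4 * (4 * ((2 : ℕ) : ℝ) + 1) ^ 4)) * ((2 : ℕ) : ℝ) ^ 2)) * (2 * liftMassC 4 2 + 4 * CPLine 4 2 (Fintype.card n) (1 / 10 ^ 17) (1 / 10 ^ 53) * liftCurlC 4 2)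
                    + (1 - (2 * curl1C 4 2 * ε * (128 * (C1cov 4 * ((2 : ℕ) : ℝ) ^ 2 * (4 * (4 * ((2 : ℕ) : ℝ) + 1) ^ 4)) * ((2 : ℕ) : ℝ) ^ 2)) * (2 * (4 * CPLine 4 2 (Fintype.card n) (1 / 10 ^ 17) (1 / 10 ^ 53) * Fintype.card n)))
                      * (2 * ((1 + θ) * (14 * (Fintype.card (T4AveragingDeficitWall.Plane 4) : ℝ) * ε) + (1 + θ⁻¹) * (36 * eC 4 2 (Fintype.card n) ^ 2 * ε ^ 2))
                        * (2 * liftMassC 4 2 + 4 * CPLine 4 2 (Fintype.card n) (1 / 10 ^ 17) (1 / 10 ^ 53) * liftCurlC 4 2)))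
                * dirSq (chartDir (ContinuousLinearMap.id ℝ (Matrix n n ℂ)) N (v : TDir 4 n N)) (periodBox N) := by
  obtain ⟨h1, h2, h3, h4, -⟩ := lines_d4_L2_c2
  have h1' : ShLine 4 2 (Fintype.card n) (1 / 10 ^ 17) (1 / 10 ^ 53) ≤ 1 / 2 := by rw [hn]; exact h1
  have h2' : SmallYLine 4 2 (Fintype.card n) (1 / 10 ^ 17) (1 / 10 ^ 53) ≤ 1 / 2 := by rw [hn]; exact h2
  have h4' : 8 * ((4 : ℕ) : ℝ) * ((((4 : ℕ) : ℝ) - 1) * (1 / 10 ^ 53 : ℝ)) ^ 2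
      + 2 * ((Fintype.card n : ℝ) * ((4 * ((4 : ℕ) : ℝ) ^ 2 + 272 * ((4 : ℕ) : ℝ) * ((((4 : ℕ) : ℝ) + 1) * (((4 : ℕ) : ℝ) + 4))) * (1 / 10 ^ 53 : ℝ)) ^ 2) ≤ 1 / 2 := by
    rw [hn]; exact h4
  exact effectiveForm_lower_bound_final_uniform (n := n) (L := 2) (by norm_num) (by norm_num) (by norm_num) h1' h2' h3 h4'

/-- **(G′) FOR SU(3) AT d = 4, L = 2, NO NUMERIC HYPOTHESIS, LEVEL-UNIFORM DATUM RADIUS** (`C_P = CPLine 4 2 3 10⁻¹⁷ 10⁻⁵³`). [folklore] -/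
theorem effectiveForm_lower_bound_SU3_L2_uniform [Nonempty n] (hn : Fintype.card n = 3) :
    ∃ ε₀ : ℝ, 0 < ε₀ ∧ ∀ ε : ℝ, 0 < ε → ε < ε₀ →
      ∀ (N : ℕ) [NeZero N], 1 ≤ N →
      ∃ δV : ℝ, 0 < δV ∧ ∀ j : ℕ,
        ∀ V₀ ∈ {V : Site 4 → Fin 4 → (Matrix n n ℂ)ˣ | IsUnitaryCfg V ∧ IsPeriodicCfg V (N : ℤ) ∧ SmallField V δV},
        ∀ Us : Site 4 → Fin 4 → (Matrix n n ℂ)ˣ, IsMinimiser 4 (sfClass 4 2 N ε) 2 N (j + 1) V₀ Us → ∀ θ : ℝ, 0 < θ →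
        ∀ v : ↥(skewSub 4 n N),
          (1 - (2 * curl1C 4 2 * ε * (128 * (C1cov 4 * ((2 : ℕ) : ℝ) ^ 2 * (4 * (4 * ((2 : ℕ) : ℝ) + 1) ^ 4)) * ((2 : ℕ) : ℝ) ^ 2)) * (2 * (4 * CPLine 4 2 (Fintype.card n) (1 / 10 ^ 17) (1 / 10 ^ 53) * Fintype.card n)))
              * (((stepWt 4 2)⁻¹) ^ (j + 1) * ∑ P ∈ perWin 4 N, nhsNormSq (curl V₀ (chartDir (ContinuousLinearMap.id ℝ (Matrix n n ℂ)) N (v : TDir 4 n N)) P))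
            ≤ ((1 + θ) + 2 * ((1 + θ) * (14 * (Fintype.card (T4AveragingDeficitWall.Plane 4) : ℝ) * ε) + (1 + θ⁻¹) * (36 * eC 4 2 (Fintype.card n) ^ 2 * ε ^ 2))
                    * (4 * CPLine 4 2 (Fintype.card n) (1 / 10 ^ 17) (1 / 10 ^ 53) * Fintype.card n))
                * fderiv ℝ (fderiv ℝ (fun y : ↥(skewSub 4 n N) => minAct 4 (sfClass 4 2 N ε) 2 N (j + 1) (chart (ContinuousLinearMap.id ℝ (Matrix n n ℂ)) N V₀ (y : TDir 4 n N)))) 0 v v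
              + ((stepWt 4 2)⁻¹) ^ (j + 1)
                * (2 * (((1 + θ) + 2 * ((1 + θ) * (14 * (Fintype.card (T4AveragingDeficitWall.Plane 4) : ℝ) * ε) + (1 + θ⁻¹) * (36 * eC 4 2 (Fintype.card n) ^ 2 * ε ^ 2))
                        * (4 * CPLine 4 2 (Fintype.card n) (1 / 10 ^ 17) (1 / 10 ^ 53) * Fintype.card n)))
                      * (2 * curl1C 4 2 * ε * (128 * (C1cov 4 * ((2 : ℕ) : ℝ) ^ 2 * (4 * (4 * ((2 : ℕ) : ℝ) + 1) ^ 4)) * ((2 : ℕ) : ℝ) ^ 2)) * (2 * liftMassC 4 2 + 4 * CPLine 4 2 (Fintype.card n) (1 / 10 ^ 17) (1 / 10 ^ 53) * liftCurlC 4 2)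
                    + (1 - (2 * curl1C 4 2 * ε * (128 * (C1cov 4 * ((2 : ℕ) : ℝ) ^ 2 * (4 * (4 * ((2 : ℕ) : ℝ) + 1) ^ 4)) * ((2 : ℕ) : ℝ) ^ 2)) * (2 * (4 * CPLine 4 2 (Fintype.card n) (1 / 10 ^ 17) (1 / 10 ^ 53) * Fintype.card n)))
                      * (2 * ((1 + θ) * (14 * (Fintype.card (T4AveragingDeficitWall.Plane 4) : ℝ) * ε) + (1 + θ⁻¹) * (36 * eC 4 2 (Fintype.card n) ^ 2 * ε ^ 2))
                        * (2 * liftMassC 4 2 + 4 * CPLine 4 2 (Fintype.card n) (1 / 10 ^ 17) (1 / 10 ^ 53) * liftCurlC 4 2)))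
                * dirSq (chartDir (ContinuousLinearMap.id ℝ (Matrix n n ℂ)) N (v : TDir 4 n N)) (periodBox N) := by
  obtain ⟨-, -, h3, -, -⟩ := lines_d4_L2_c2
  obtain ⟨h1, h2, h4, -⟩ := lines_d4_L2_c3
  have h1' : ShLine 4 2 (Fintype.card n) (1 / 10 ^ 17) (1 / 10 ^ 53) ≤ 1 / 2 := by rw [hn]; exact h1
  have h2' : SmallYLine 4 2 (Fintype.card n) (1 / 10 ^ 17) (1 / 10 ^ 53) ≤ 1 / 2 := by rw [hn]; exact h2
  have h4' : 8 * ((4 : ℕ) : ℝ) * ((((4 : ℕ) : ℝ) - 1) * (1 / 10 ^ 53 : ℝ)) ^ 2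
      + 2 * ((Fintype.card n : ℝ) * ((4 * ((4 : ℕ) : ℝ) ^ 2 + 272 * ((4 : ℕ) : ℝ) * ((((4 : ℕ) : ℝ) + 1) * (((4 : ℕ) : ℝ) + 4))) * (1 / 10 ^ 53 : ℝ)) ^ 2) ≤ 1 / 2 := by
    rw [hn]; exact h4
  exact effectiveForm_lower_bound_final_uniform (n := n) (L := 2) (by norm_num) (by norm_num) (by norm_num) h1' h2' h3 h4'

end

end Summit.QuantumFields.BalabanUV.T4Continuum.NE7EffectiveFormLowerBoundFinalUniform
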